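import Mathlib
import HarnessLib
import Literature.NumberTheory.Automorphic.MeyerDifferenceRepresentation

/-!
# Route `RuelleBand` — definitions posited by line `interior-edge-split` of the crux `AsymptoticCriticalLine`:
# the LASOTA–YORKE LANDING DATUM on Meyer's coinvariant space `H⁰₋(ℚ)`

Route `RiemannHypothesis/RuelleBand`, crux item stmt-RiemannHypothesis-2063 (`AsymptoticCriticalLine`,
"ACL"), line `interior-edge-split` (lead prover-line-stmt-RiemannHypothesis-2063-1). This file collects the
two DEFINITIONS that type the route's programme item `MeyerLasotaYorke` (stmt-RiemannHypothesis-11050,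
informal so far) against the Lasota–Yorke ENGINE now proved in the tree
(`Theorems/RuelleBandAsymptoticCriticalLine{HennionDecomposition,HennionQuasiCompact,LasotaYorkeEngine,
LasotaYorkePreHilbert,LasotaYorkeSeminormed,LasotaYorkeRate,LasotaYorkeConverse,SpectralRadiusRH}.lean`):

* `RuelleBand.meyerScaling μ t` — the HALF-DENSITY-NORMALISED ARCHIMEDEAN SCALING on Meyer's `H⁰₋(ℚ)`:
  `T_t := e^{-t/2} · π₋([exp t]_∞)`, where `π₋` is Meyer's representation of the idele class group
  `C_ℚ` on `H⁰₋ = (H₊ + H₋)/H₊` (`Literature.NumberTheory.Automorphic.Meyer.piMinus`, [Meyer2005 §5.5])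
  and `[exp t]_∞ = Meyer.archExpClass ℚ (archDir t)` is the class of the idele that is `e^t` at the
  real place and `1` at the finite places. In the route's dictionary this is the transfer operator
  `e^{tA}`, `A = -X + V₀` with the half-density potential; Meyer's Theorem 5.11 (tree named fact
  `Meyer.spectralRealisation_rat`) makes every non-trivial zero `ρ` of `ζ` a joint eigen-character
  `t ↦ e^{t(ρ - 1/2)}` of it.
* `RuelleBand.IsMeyerLasotaYorkeDatum μ core Nw t₀` — the LANDING PREDICATE: a positive-semidefinite
  sesquilinear form `core` on `H⁰₋(ℚ)` (Mathlib `PreInnerProductSpace.Core`; its seminorm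
  `‖f‖_s = √re⟪f,f⟫` is the pinned STRONG norm, `InnerProductSpace.Core.toSeminormedAddCommGroup`), a
  WEAK seminorm `Nw`, and a time `t₀ > 0`, such that: `Nw ≤ c ‖·‖_s`; each `T_t` (`t ≥ 0`) is
  `‖·‖_s`-bounded; the `‖·‖_s`-unit ball has finite `Nw`-nets (compact embedding); the A-PRIORI two-norm
  Lasota–Yorke inequality `‖T_{t₀}ⁿ f‖_s ≤ C_ε e^{n ε t₀} ‖f‖_s + R_{n,ε} Nw(f)` holds for EVERY `ε > 0`
  (rate `λ = 0`; by `…LasotaYorkeRate` no windowed rate helps, by `…SpectralRadiusRH` `Nw = 0` would be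
  RH, by `…LasotaYorkeConverse` the abstract `∃`-version is implied by the crux itself — so `core`, `Nw`
  must be PINNED by the constructor, never quantified); and every zero of `ζ` in the open strip has a one-sided joint
  eigenvector of NON-ZERO strong seminorm (the route's clause "‖·‖_s non-zero on Meyer's spectral
  subspaces"). This is the exact hypothesis list of `asymptoticCriticalLine_of_lasotaYorkeSeminormed`
  instantiated on Meyer's objects; the bridge `IsMeyerLasotaYorkeDatum … → AsymptoticCriticalLine` is
  the prover file `RuelleBandAsymptoticCriticalLineMeyerDatum.lean`.

Design: `μ` is a parameter (it must be the self-dual Haar measure on `𝔸_ℚ` for Meyer's theorem to apply;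
that normalisation belongs to the item that USES the named fact, not to this shape). No `∃` over the
datum anywhere. Nothing here is progress on `ζ`: it is the typed form of the statement the route says
must be SIGNED (typing constraints (α)–(δ) of the route rationale). References: R. Meyer, Duke Math. J.
127 (2005) §§1, 5 [Meyer2005]; H. Hennion, Proc. AMS 118 (1993); V. Baladi, *Positive transfer operators
and decay of correlations* (2000) §2.3; F. Faure–M. Tsujii, arXiv:1301.5525 §3.
-/

noncomputable section

-- D-0017: `Summit.<S>.<S>.…` is the designed namespace of a single-problem summit.
set_option linter.dupNamespace false

namespace Summit.RiemannHypothesis.RiemannHypothesis.Theorems.RuelleBand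

open Literature.NumberTheory.Automorphic MeasureTheory NumberField

/-- The archimedean direction of parameter `t` in `ℚ_∞ ≅ ℝ^{r₁} × ℂ^{r₂}` (`r₁ = 1`, `r₂ = 0` for `ℚ`):
the vector whose real coordinate is `t` (the complex part is indexed by the empty type). [folklore] -/
def archDir (t : ℝ) : mixedEmbedding.mixedSpace ℚ :=
  (fun _ => t, fun _ => 0)

/-- `archDir` is additive. [folklore] -/
theorem archDir_add (s t : ℝ) : archDir (s + t) = archDir s + archDir t := by
  refine Prod.ext (funext fun _ => rfl) (funext fun _ => ?_)
  simp [archDir]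

/-- `archDir 0 = 0`. [folklore] -/
theorem archDir_zero : archDir 0 = 0 := by
  refine Prod.ext (funext fun _ => rfl) (funext fun _ => ?_)
  simp [archDir]

variable [MeasurableSpace (AdeleRing (𝓞 ℚ) ℚ)]

/-- **The half-density-normalised archimedean scaling on Meyer's `H⁰₋(ℚ)`**:
`T_t := e^{-t/2} · π₋([exp t]_∞)` as a `ℂ`-linear map (`π₋ = Meyer.piMinus ℚ μ`,
`[exp t]_∞ = Meyer.archExpClass ℚ (archDir t)`). The factor `e^{-t/2}` is the half-density potential:
it moves Meyer's eigen-characters `|x|^ρ` to `e^{t(ρ - 1/2)}`, centring the first band on the unit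
circle. [cite: Meyer2005, §5.5 and Thm 5.11] -/
def meyerScaling (μ : Measure (AdeleRing (𝓞 ℚ) ℚ)) (t : ℝ) :
    Meyer.HzeroMinus ℚ μ →ₗ[ℂ] Meyer.HzeroMinus ℚ μ :=
  ((Real.exp (-(t / 2)) : ℝ) : ℂ) • Meyer.piMinus ℚ μ (Meyer.archExpClass ℚ (archDir t))

/-- **The Lasota–Yorke LANDING DATUM for `MeyerLasotaYorke` (stmt-RiemannHypothesis-11050).**
For a measure `μ` on `𝔸_ℚ` (intended: the self-dual Haar measure), a positive-semidefinite
sesquilinear form `core` on Meyer's `H⁰₋(ℚ)` (the PINNED strong pre-Hilbert seminorm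
`‖f‖_s = √re⟪f,f⟫`), a weak seminorm `Nw` and a time `t₀`: `t₀ > 0`; `Nw ≤ c‖·‖_s`; every `T_t`
(`t ≥ 0`, `meyerScaling`) is `‖·‖_s`-bounded; the `‖·‖_s`-unit ball has finite `Nw`-nets; the a-priori
two-norm Lasota–Yorke inequality `‖T_{t₀}ⁿ f‖_s ≤ C_ε e^{nεt₀}‖f‖_s + R_{n,ε} Nw f` for every `ε > 0`;
and every zero `ρ` of `ζ` with `0 < Re ρ < 1` has `v` with `‖v‖_s ≠ 0` and
`T_t v = e^{t(ρ - 1/2)} v` for all `t ≥ 0`. By `asymptoticCriticalLine_of_lasotaYorkeSeminormed` such a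
datum proves the crux `AsymptoticCriticalLine`; over ABSTRACT Hilbert-space data the same hypothesis
list is implied back by the crux (`lasotaYorkeRealisation_of_asymptoticCriticalLine`, the diagonal
model), so merely positing the existence of a datum is no progress — `core` and `Nw` must be
CONSTRUCTED (pinned), which is the research content of the programme item. [folklore] -/
def IsMeyerLasotaYorkeDatum (μ : Measure (AdeleRing (𝓞 ℚ) ℚ))
    (core : PreInnerProductSpace.Core ℂ (Meyer.HzeroMinus ℚ μ))
    (Nw : Seminorm ℂ (Meyer.HzeroMinus ℚ μ)) (t₀ : ℝ) : Prop :=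
  letI : SeminormedAddCommGroup (Meyer.HzeroMinus ℚ μ) :=
    InnerProductSpace.Core.toSeminormedAddCommGroup (c := core)
  0 < t₀ ∧
  (∃ c : ℝ, ∀ f, Nw f ≤ c * ‖f‖) ∧
  (∀ t : ℝ, 0 ≤ t → ∃ M : ℝ, ∀ f, ‖meyerScaling μ t f‖ ≤ M * ‖f‖) ∧
  (∀ η : ℝ, 0 < η → ∃ F : Finset (Meyer.HzeroMinus ℚ μ), ∀ f, ‖f‖ ≤ 1 → ∃ g ∈ F, Nw (f - g) < η) ∧
  (∀ ε : ℝ, 0 < ε → ∃ C : ℝ, ∀ n : ℕ, ∃ R : ℝ, ∀ f,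
      ‖((meyerScaling μ t₀) ^ n) f‖ ≤ C * Real.exp (n * ε * t₀) * ‖f‖ + R * Nw f) ∧
  (∀ s : ℂ, riemannZeta s = 0 → 0 < s.re → s.re < 1 →
      ∃ v, ‖v‖ ≠ 0 ∧ ∀ t : ℝ, 0 ≤ t → meyerScaling μ t v = Complex.exp (t * (s - 1 / 2)) • v)

end Summit.RiemannHypothesis.RiemannHypothesis.Theorems.RuelleBand

namespace Summit.RiemannHypothesis.RiemannHypothesis.Theorems.RuelleBand

open Literature.NumberTheory.Automorphic MeasureTheory NumberField

/-- Sanity (registered stub `isMeyerLasotaYorkeDatum_pos`): the landing datum records a positive time.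
[folklore] -/
theorem isMeyerLasotaYorkeDatum_pos :
    ∀ [MeasurableSpace (NumberField.AdeleRing (NumberField.RingOfIntegers ℚ) ℚ)] (μ : MeasureTheory.Measure (NumberField.AdeleRing (NumberField.RingOfIntegers ℚ) ℚ)) (core : PreInnerProductSpace.Core ℂ (Literature.NumberTheory.Automorphic.Meyer.HzeroMinus ℚ μ)) (Nw : Seminorm ℂ (Literature.NumberTheory.Automorphic.Meyer.HzeroMinus ℚ μ)) (t₀ : ℝ), Summit.RiemannHypothesis.RiemannHypothesis.Theorems.RuelleBand.IsMeyerLasotaYorkeDatum μ core Nw t₀ → 0 < t₀ :=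
  fun _ _ _ _ h => h.1

end Summit.RiemannHypothesis.RiemannHypothesis.Theorems.RuelleBand

end
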